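import Literature.Analysis.FluidPDE.KatoLaiCylinderPressure
import Literature.Analysis.FluidPDE.TorusTameCommutator
import HarnessLib

/-!
# Kato–Lai's nonlinear operator for the periodic cylinder, read on the flat torus

Analysis/FluidPDE support file for the energy-method construction of Euler flows in the
periodic cylinder (`Literature.Analysis.FluidPDE.KatoLai1984_periodicCylinderUniformExistence`;
Kato–Lai 1984, §5 (5.6) `A(u) = F(Pu, u) − QF(Pu, Pu)`, §7 (7.1) extension/restriction, and the
coercivity estimate (5.8) `|(v | A v)_s| ≤ c ‖v‖_{s₀} ‖v‖²_s`). For `L > 0` and a smooth real field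
`U` on the flat torus `T³` let `u = fromTorus L U` (a smooth `L`-periodic field on `ℝ³`),
`w = P u` its Leray part on the cylinder and `∇_K π = Q((w·∇_K)w)` (`KatoLaiCylinderPressure`).

* `transportRep L U` — the torus representative of the rescaled transport field
  `a⁻¹ w = (w₀/4, w₁/4, w₂/L)` (box weights), `pressureRep L U` — that of `∇_K π`;
* `klOp L U = (transportRep L U · ∇) U − pressureRep L U` — **the operator on the torus**;
  smooth (`isSmooth_klOp`), and **restricting to Kato–Lai's `A(u)`**:
  `fromTorus L (klOp L U) = (w·∇)u − ∇_K π` on the closed cylinder (`fromTorus_klOp_eq`);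
* `exists_latNormSq_transportRep_le`, `exists_latNormSq_pressureRep_le` — lattice energies:
  `lat_m(transportRep) ≤ C lat_m(U)`, `lat_m(pressureRep) ≤ C lat₃(U) lat_m(U)` (`m ≥ 1`);
* `exists_abs_pairing_klOp_le` — **the tame coercivity estimate**: for `m ≥ 3` there is `K` with
  `|∫ ⟪klOp U, U⟫ + ∑ᵢ ∫ ⟪∂ᵢᵐ klOp U, ∂ᵢᵐ U⟫| ≤ K √(lat₃ U) (lat₀ U + lat_m U)` for all smooth `U`.

Everything is proved; no named fact and no `sorry` is introduced.

## References

* T. Kato, C. Y. Lai, J. Funct. Anal. 56 (1984) 15–28, §4 (4.2)–(4.5), §5 (5.6)–(5.8), §7 (7.1).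
  [KatoLai1984]
-/

noncomputable section

open MeasureTheory Set Function Filter Topology TopologicalSpace WithLp Finset
open scoped ContDiff NNReal ENNReal InnerProductSpace RealInnerProductSpace

namespace Literature.Analysis.FluidPDE

open FunctionSpaces FunctionSpaces.Torus UnitAddTorus

/-- Local notation for physical space `ℝ³ = EuclideanSpace ℝ (Fin 3)`. -/
local notation "ℝ³" => EuclideanSpace ℝ (Fin 3)

/-- Local notation for the closed cylinder `{r ≤ 1}`. -/
local notation "𝕂" => closure (SetLike.coe unitCylinder : Set (EuclideanSpace ℝ (Fin 3)))

namespace Torus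

variable {d : Type*} [Fintype d] [DecidableEq d] {F : Type*} [NormedAddCommGroup F] [NormedSpace ℝ F]

/-- Word derivatives of differences of smooth functions. [folklore] -/
theorem wordDeriv_fun_sub {f g : UnitAddTorus d → F} (hf : IsSmooth f) (hg : IsSmooth g) (w : List d) :
    wordDeriv w (fun x => f x - g x) = fun x => wordDeriv w f x - wordDeriv w g x := by
  have e : (fun x => f x - g x) = fun x => ∑ b : Bool, (if b then f x else (-1 : ℝ) • g x) := by
    funext x; simp [sub_eq_add_neg]
  have hneg : IsSmooth (fun x => (-1 : ℝ) • g x) := hg.smul (-1 : ℝ)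
  have hs : ∀ b ∈ (Finset.univ : Finset Bool), IsSmooth (fun x => if b then f x else (-1 : ℝ) • g x) := by
    intro b _
    cases b
    · exact hneg
    · exact hf
  rw [e, wordDeriv_fun_sum _ hs w]
  funext x
  rw [Fintype.sum_bool]
  simp only [if_true, Bool.false_eq_true, if_false]
  rw [wordDeriv_fun_const_smul (-1 : ℝ) hg w]
  simp only [neg_one_smul, sub_eq_add_neg]

end Torus

namespace PeriodicCylinder

variable {L : ℝ}

/-! ### Smooth torus fields restrict to smooth periodic fields -/

/-- `fromTorus L U` is smooth periodic (`L ≠ 0`). [folklore] -/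
theorem isSmoothPeriodic_fromTorus (hL : L ≠ 0) {F : Type*} [NormedAddCommGroup F] [NormedSpace ℝ F]
    {U : UnitAddTorus (Fin 3) → F} (hU : IsSmooth U) : IsSmoothPeriodic L (fromTorus L U) :=
  ⟨(contDiff_fromTorus L hU).contDiffOn, isAxiallyPeriodic_fromTorus hL U⟩

/-- The cell Sobolev norms of `fromTorus L U` by the lattice energies, squared real form:
`‖fromTorus L U‖²_{W^{m,2}(cell)} ≤ C lat_m(U)`. [folklore] -/
theorem exists_toReal_eSobolevDomainNorm_fromTorus_sq_le (hL : 0 < L) (m : ℕ) : ∃ C : ℝ, 0 ≤ C ∧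
    ∀ (U : UnitAddTorus (Fin 3) → ℝ³), IsSmooth U →
      (eSobolevDomainNorm m 2 (cylinderCell L) volume (fromTorus L U)).toReal ^ 2 ≤ C * Torus.latNormSq m U := by
  obtain ⟨C, hC0, hC⟩ := exists_eSobolevDomainNorm_fromTorus_le hL m
  refine ⟨C ^ 2, by positivity, fun U hU => ?_⟩
  have h := hC U hU
  have hlat : Torus.latNormSq m U = ∑' k : Fin 3 → ℤ, (1 + freqNormSq k) ^ m * ‖mFourierCoeff (EuclideanSpace.complexify ∘ U) k‖ ^ 2 := rfl
  rw [← hlat] at h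
  have h0 := Torus.latNormSq_nonneg m U
  have h1 : (eSobolevDomainNorm m 2 (cylinderCell L) volume (fromTorus L U)).toReal ≤ C * Real.sqrt (Torus.latNormSq m U) := by
    have := ENNReal.toReal_mono ENNReal.ofReal_ne_top h
    rwa [ENNReal.toReal_ofReal (by positivity)] at this
  calc (eSobolevDomainNorm m 2 (cylinderCell L) volume (fromTorus L U)).toReal ^ 2
      ≤ (C * Real.sqrt (Torus.latNormSq m U)) ^ 2 := pow_le_pow_left₀ ENNReal.toReal_nonneg h1 2
    _ = C ^ 2 * Torus.latNormSq m U := by rw [mul_pow, Real.sq_sqrt h0]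

/-! ### The operator -/

section Op

variable (L)

/-- **The rescaled transport field on the torus**: the representative of `a⁻¹ · P(fromTorus L U)`.
[cite: KatoLai1984, §5 (5.6)] -/
def transportRep (hL : 0 < L) {U : UnitAddTorus (Fin 3) → ℝ³} (hU : IsSmooth U) : UnitAddTorus (Fin 3) → ℝ³ :=
  torusRep L fun x => boxInvLin L (lerayPart hL (isSmoothPeriodic_fromTorus hL.ne' hU) x)

/-- **The pressure field on the torus**: the representative of `∇_K π = Q((w·∇_K)w)`.
[cite: KatoLai1984, §5 (5.6)] -/
def pressureRep (hL : 0 < L) {U : UnitAddTorus (Fin 3) → ℝ³} (hU : IsSmooth U) : UnitAddTorus (Fin 3) → ℝ³ :=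
  torusRep L (pressureGrad hL (isSmoothPeriodic_fromTorus hL.ne' hU))

/-- **Kato–Lai's operator on the torus** `𝒜 U = (transportRep · ∇) U − pressureRep`.
[cite: KatoLai1984, §5 (5.6)] -/
def klOp (hL : 0 < L) {U : UnitAddTorus (Fin 3) → ℝ³} (hU : IsSmooth U) : UnitAddTorus (Fin 3) → ℝ³ :=
  fun ξ => Torus.convect (transportRep L hL hU) U ξ - pressureRep L hL hU ξ

end Op

section Props

variable (hL : 0 < L) {U : UnitAddTorus (Fin 3) → ℝ³} (hU : IsSmooth U)

/-- The rescaled Leray part is smooth periodic. [folklore] -/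
theorem isSmoothPeriodic_scaled_lerayPart :
    IsSmoothPeriodic L fun x => boxInvLin L (lerayPart hL (isSmoothPeriodic_fromTorus hL.ne' hU) x) := by
  have hw := isSmoothPeriodic_lerayPart hL (isSmoothPeriodic_fromTorus hL.ne' hU)
  exact ⟨(boxInvLin L).contDiff.comp_contDiffOn hw.smooth, fun x => by simp only [hw.periodic x]⟩

/-- The transport representative is smooth. [folklore] -/
theorem isSmooth_transportRep : IsSmooth (transportRep L hL hU) :=
  isSmooth_torusRep (isSmoothPeriodic_scaled_lerayPart hL hU)

/-- The pressure representative is smooth. [folklore] -/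
theorem isSmooth_pressureRep : IsSmooth (pressureRep L hL hU) :=
  isSmooth_torusRep (isSmoothPeriodic_pressureGrad hL (isSmoothPeriodic_fromTorus hL.ne' hU))

/-- **The operator is smooth.** [folklore] -/
theorem isSmooth_klOp : IsSmooth (klOp L hL hU) :=
  ((isSmooth_transportRep hL hU).convect hU).sub (isSmooth_pressureRep hL hU)

/-- **The convective part restricts to `(w·∇)u`**: on the closed cylinder
`fromTorus L ((transportRep · ∇) U) = D(fromTorus L U)[w]`, `w = P(fromTorus L U)`. [folklore] -/
theorem fromTorus_convect_transportRep {x : ℝ³} (hx : x ∈ 𝕂) :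
    fromTorus L (Torus.convect (transportRep L hL hU) U) x =
      fderiv ℝ (fromTorus L U) x (lerayPart hL (isSmoothPeriodic_fromTorus hL.ne' hU) x) := by
  have hw := isSmoothPeriodic_scaled_lerayPart hL hU
  -- the derivative of `fromTorus L U = lift U ∘ boxInv L`
  have hlift : ContDiff ℝ ∞ (lift U) := hU
  have hd : fderiv ℝ (fromTorus L U) x = (fderiv ℝ (lift U) (boxInv L x)).comp (boxInvLin L) := by
    have h1 : HasFDerivAt (boxInv L) (boxInvLin L) x := by
      rw [show boxInv L = fun x => boxInvLin L x + toLp 2 fun i => -((boxSide L i)⁻¹ * boxOff i) from funext (boxInv_eq L)]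
      exact (boxInvLin L).hasFDerivAt.add_const _
    exact (((hlift.differentiable (by simp)) _).hasFDerivAt.comp x h1).fderiv
  rw [hd, ContinuousLinearMap.comp_apply, fderiv_lift]
  -- the left-hand side
  show Torus.fderiv U (proj (boxInv L x)) (transportRep L hL hU (proj (boxInv L x))) = _
  congr 1
  exact fromTorus_torusRep_of_mem_K hL hw.periodic hx

/-- **The operator restricts to Kato–Lai's `A(u) = F(Pu, u) − QF(Pu, Pu)`** on the closed cylinder.
[cite: KatoLai1984, §5 (5.6)] -/
theorem fromTorus_klOp_eq {x : ℝ³} (hx : x ∈ 𝕂) :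
    fromTorus L (klOp L hL hU) x =
      fderiv ℝ (fromTorus L U) x (lerayPart hL (isSmoothPeriodic_fromTorus hL.ne' hU) x) -
        pressureGrad hL (isSmoothPeriodic_fromTorus hL.ne' hU) x := by
  have h1 := fromTorus_convect_transportRep hL hU hx
  have h2 := fromTorus_torusRep_of_mem_K hL (isSmoothPeriodic_pressureGrad hL (isSmoothPeriodic_fromTorus hL.ne' hU)).periodic hx
  simp only [fromTorus, lift_apply, klOp] at h1 h2 ⊢
  rw [← h1]
  unfold pressureRep at *
  rw [h2]

end Props

/-! ### Lattice energies of the two representatives -/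

/-- **`lat_m(transportRep) ≤ C lat_m(U)`** for `m ≥ 1`. [cite: KatoLai1984, §4 (i)] -/
theorem exists_latNormSq_transportRep_le (hL : 0 < L) {m : ℕ} (hm : 1 ≤ m) : ∃ C : ℝ, 0 ≤ C ∧
    ∀ (U : UnitAddTorus (Fin 3) → ℝ³) (hU : IsSmooth U),
      Torus.latNormSq m (transportRep L hL hU) ≤ C * Torus.latNormSq m U := by
  obtain ⟨N, rfl⟩ : ∃ N, m = N + 1 := ⟨m - 1, by omega⟩
  obtain ⟨C₁, hC₁0, hC₁⟩ := exists_latNormSq_torusRep_le hL (N + 1)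
  obtain ⟨CP, hCP⟩ := exists_leray_bound hL N
  obtain ⟨C₂, hC₂0, hC₂⟩ := exists_toReal_eSobolevDomainNorm_fromTorus_sq_le hL (N + 1)
  refine ⟨C₁ * (‖boxInvLin L‖ * (1 + CP)) ^ 2 * C₂, by positivity, fun U hU => ?_⟩
  have hu := isSmoothPeriodic_fromTorus hL.ne' hU
  have hw := isSmoothPeriodic_lerayPart hL hu
  have hws := isSmoothPeriodic_scaled_lerayPart hL hU
  have hcell : (cylinderCell L : Set ℝ³) ⊆ 𝕂 := fun x hx => subset_closure (cylinderCell_le_unitCylinder L hx)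
  have h1 := hC₁ _ hws
  -- the cell norm of the rescaled Leray part
  have hfin : eSobolevDomainNorm (N + 1) 2 (cylinderCell L) volume (fromTorus L U) < ⊤ :=
    eSobolevDomainNorm_lt_top_of_isSmoothPeriodic L (N + 1) hu.smooth
  have h2 : eSobolevDomainNorm (N + 1) 2 (cylinderCell L) volume (fun x => boxInvLin L (lerayPart hL hu x)) ≤
      ((‖boxInvLin L‖₊ * (1 + CP) : ℝ≥0) : ℝ≥0∞) * eSobolevDomainNorm (N + 1) 2 (cylinderCell L) volume (fromTorus L U) := by
    refine (eSobolevDomainNorm_clm_comp_le (Ω := cylinderCell L) (p := 2) (μ := volume) (boxInvLin L) (N + 1)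
      (hw.smooth.mono hcell)).trans ?_
    rw [ENNReal.coe_mul, mul_assoc]
    exact mul_le_mul' le_rfl (hCP hu).2
  have h2' : (eSobolevDomainNorm (N + 1) 2 (cylinderCell L) volume (fun x => boxInvLin L (lerayPart hL hu x))).toReal ≤
      (‖boxInvLin L‖ * (1 + CP)) * (eSobolevDomainNorm (N + 1) 2 (cylinderCell L) volume (fromTorus L U)).toReal := by
    have := ENNReal.toReal_mono (ENNReal.mul_ne_top ENNReal.coe_ne_top hfin.ne) h2
    rw [ENNReal.toReal_mul, ENNReal.coe_toReal, NNReal.coe_mul, NNReal.coe_add, NNReal.coe_one, coe_nnnorm] at this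
    exact this
  have h3 := hC₂ U hU
  have hE0 : 0 ≤ (eSobolevDomainNorm (N + 1) 2 (cylinderCell L) volume (fromTorus L U)).toReal := ENNReal.toReal_nonneg
  calc Torus.latNormSq (N + 1) (transportRep L hL hU)
      ≤ C₁ * (eSobolevDomainNorm (N + 1) 2 (cylinderCell L) volume (fun x => boxInvLin L (lerayPart hL hu x))).toReal ^ 2 := h1
    _ ≤ C₁ * (((‖boxInvLin L‖ * (1 + CP)) * (eSobolevDomainNorm (N + 1) 2 (cylinderCell L) volume (fromTorus L U)).toReal)) ^ 2 :=
        mul_le_mul_of_nonneg_left (pow_le_pow_left₀ ENNReal.toReal_nonneg h2' 2) hC₁0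
    _ = C₁ * (‖boxInvLin L‖ * (1 + CP)) ^ 2 * (eSobolevDomainNorm (N + 1) 2 (cylinderCell L) volume (fromTorus L U)).toReal ^ 2 := by ring
    _ ≤ C₁ * (‖boxInvLin L‖ * (1 + CP)) ^ 2 * (C₂ * Torus.latNormSq (N + 1) U) := mul_le_mul_of_nonneg_left h3 (by positivity)
    _ = _ := by ring

/-- **`lat_m(pressureRep) ≤ C lat₃(U) lat_m(U)`** for `m ≥ 1`. [cite: KatoLai1984, §4 (4.4)] -/
theorem exists_latNormSq_pressureRep_le (hL : 0 < L) {m : ℕ} (hm : 1 ≤ m) : ∃ C : ℝ, 0 ≤ C ∧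
    ∀ (U : UnitAddTorus (Fin 3) → ℝ³) (hU : IsSmooth U),
      Torus.latNormSq m (pressureRep L hL hU) ≤ C * (Torus.latNormSq 3 U * Torus.latNormSq m U) := by
  obtain ⟨C₁, hC₁0, hC₁⟩ := exists_latNormSq_torusRep_le hL m
  obtain ⟨CP, hCP⟩ := exists_pressureGrad_le hL hm
  obtain ⟨C₃, hC₃0, hC₃⟩ := exists_toReal_eSobolevDomainNorm_fromTorus_sq_le hL 3
  obtain ⟨Cm, hCm0, hCm⟩ := exists_toReal_eSobolevDomainNorm_fromTorus_sq_le hL m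
  refine ⟨C₁ * (CP : ℝ) ^ 2 * C₃ * Cm, by positivity, fun U hU => ?_⟩
  have hu := isSmoothPeriodic_fromTorus hL.ne' hU
  have hπ := isSmoothPeriodic_pressureGrad hL hu
  have h1 := hC₁ _ hπ
  set E3 := eSobolevDomainNorm 3 2 (cylinderCell L) volume (fromTorus L U) with hE3
  set Em := eSobolevDomainNorm m 2 (cylinderCell L) volume (fromTorus L U) with hEm
  have h3f : E3 < ⊤ := eSobolevDomainNorm_lt_top_of_isSmoothPeriodic L 3 hu.smooth
  have hmf : Em < ⊤ := eSobolevDomainNorm_lt_top_of_isSmoothPeriodic L m hu.smooth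
  have h2 : (eSobolevDomainNorm m 2 (cylinderCell L) volume (pressureGrad hL hu)).toReal ≤ CP * E3.toReal * Em.toReal := by
    have := ENNReal.toReal_mono (ENNReal.mul_ne_top (ENNReal.mul_ne_top ENNReal.coe_ne_top h3f.ne) hmf.ne) (hCP hu)
    rw [ENNReal.toReal_mul, ENNReal.toReal_mul] at this
    simpa using this
  have h33 := hC₃ U hU
  have hmm := hCm U hU
  calc Torus.latNormSq m (pressureRep L hL hU)
      ≤ C₁ * (eSobolevDomainNorm m 2 (cylinderCell L) volume (pressureGrad hL hu)).toReal ^ 2 := h1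
    _ ≤ C₁ * (CP * E3.toReal * Em.toReal) ^ 2 := mul_le_mul_of_nonneg_left (pow_le_pow_left₀ ENNReal.toReal_nonneg h2 2) hC₁0
    _ = C₁ * (CP : ℝ) ^ 2 * (E3.toReal ^ 2 * Em.toReal ^ 2) := by ring
    _ ≤ C₁ * (CP : ℝ) ^ 2 * ((C₃ * Torus.latNormSq 3 U) * (Cm * Torus.latNormSq m U)) :=
        mul_le_mul_of_nonneg_left (mul_le_mul h33 hmm (by positivity) (by have := Torus.latNormSq_nonneg 3 U; positivity))
          (by positivity)
    _ = _ := by ring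

/-! ### The tame coercivity estimate -/

/-- `|∫ ⟪f, g⟫| ≤ √(∫‖f‖²) √(∫‖g‖²)` for smooth torus fields. [folklore] -/
theorem abs_integral_inner_le_sqrt_mul_sqrt {f g : UnitAddTorus (Fin 3) → ℝ³} (hf : IsSmooth f) (hg : IsSmooth g) :
    |∫ ξ, ⟪f ξ, g ξ⟫| ≤ Real.sqrt (∫ ξ, ‖f ξ‖ ^ 2) * Real.sqrt (∫ ξ, ‖g ξ‖ ^ 2) := by
  calc |∫ ξ, ⟪f ξ, g ξ⟫| ≤ ∫ ξ, |⟪f ξ, g ξ⟫| := abs_integral_le_integral_abs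
    _ ≤ ∫ ξ, ‖f ξ‖ * ‖g ξ‖ :=
        integral_mono_of_nonneg (ae_of_all _ fun ξ => abs_nonneg _)
          ((hf.continuous.norm.mul hg.continuous.norm).integrable_unitAddTorus) (ae_of_all _ fun ξ => abs_real_inner_le_norm _ _)
    _ ≤ _ := GalerkinSmooth.integral_norm_mul_norm_le hf hg

/-- **The tame coercivity estimate** (Kato–Lai's (5.8) with `s₀ = 3`): for `m ≥ 3` there is `K`
with `|∫ ⟪𝒜U, U⟫ + ∑ᵢ ∫ ⟪∂ᵢᵐ 𝒜U, ∂ᵢᵐ U⟫| ≤ K √(lat₃ U) (lat₀ U + lat_m U)` for every smooth `U`.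
[cite: KatoLai1984, §5 (5.8)] -/
theorem exists_abs_pairing_klOp_le (hL : 0 < L) {m : ℕ} (hm : 3 ≤ m) : ∃ K : ℝ, 0 ≤ K ∧
    ∀ (U : UnitAddTorus (Fin 3) → ℝ³) (hU : IsSmooth U),
      |(∫ ξ, ⟪klOp L hL hU ξ, U ξ⟫) +
          ∑ i, ∫ ξ, ⟪(Torus.partialDeriv i)^[m] (klOp L hL hU) ξ, (Torus.partialDeriv i)^[m] U ξ⟫| ≤
        K * Real.sqrt (Torus.latNormSq 3 U) * (Torus.latNormSq 0 U + Torus.latNormSq m U) := by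
  have hd : Fintype.card (Fin 3) = 3 := by simp
  obtain ⟨C₀, hC₀0, hC₀⟩ := Torus.exists_abs_integral_inner_convect_le (d := Fin 3) hd
  obtain ⟨Cc, hCc0, hCc⟩ := Torus.exists_abs_integral_inner_iterate_convect_le (d := Fin 3) hd hm
  obtain ⟨CW3, hCW30, hCW3⟩ := exists_latNormSq_transportRep_le hL (m := 3) (by norm_num)
  obtain ⟨CWm, hCWm0, hCWm⟩ := exists_latNormSq_transportRep_le hL (m := m) (by omega)
  obtain ⟨CG1, hCG10, hCG1⟩ := exists_latNormSq_pressureRep_le hL (m := 1) le_rfl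
  obtain ⟨CGm, hCGm0, hCGm⟩ := exists_latNormSq_pressureRep_le hL (m := m) (by omega)
  set q : ℝ := 4 * Real.pi ^ 2 with hq
  have hq1 : 1 ≤ q := by rw [hq]; nlinarith [Real.pi_gt_three]
  -- a generous common constant
  refine ⟨C₀ * Real.sqrt CW3 + Real.sqrt CG1 + 3 * (Cc * (Real.sqrt CW3 + Real.sqrt CWm) + q ^ m * Real.sqrt CGm),
    by positivity, fun U hU => ?_⟩
  have hW := isSmooth_transportRep hL hU
  have hG := isSmooth_pressureRep hL hU
  have hA := isSmooth_klOp hL hU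
  set W := transportRep L hL hU with hWdef
  set G := pressureRep L hL hU with hGdef
  have l0 := Torus.latNormSq_nonneg 0 U
  have l1 := Torus.latNormSq_nonneg 1 U
  have l3 := Torus.latNormSq_nonneg 3 U
  have lm := Torus.latNormSq_nonneg m U
  have hl01 : Torus.latNormSq 0 U ≤ Torus.latNormSq 1 U := Torus.latNormSq_mono hU (by norm_num)
  have hl1m : Torus.latNormSq 1 U ≤ Torus.latNormSq m U := Torus.latNormSq_mono hU (by omega)
  have hl3m : Torus.latNormSq 3 U ≤ Torus.latNormSq m U := Torus.latNormSq_mono hU hm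
  -- lattice energies of `W` and `G`
  have hW3 : Real.sqrt (Torus.latNormSq 3 W) ≤ Real.sqrt CW3 * Real.sqrt (Torus.latNormSq 3 U) := by
    rw [← Real.sqrt_mul hCW30]; exact Real.sqrt_le_sqrt (hCW3 U hU)
  have hWm : Real.sqrt (Torus.latNormSq m W) ≤ Real.sqrt CWm * Real.sqrt (Torus.latNormSq m U) := by
    rw [← Real.sqrt_mul hCWm0]; exact Real.sqrt_le_sqrt (hCWm U hU)
  have hG0 : Real.sqrt (Torus.latNormSq 0 G) ≤ Real.sqrt CG1 * Real.sqrt (Torus.latNormSq 3 U) * Real.sqrt (Torus.latNormSq 1 U) := by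
    rw [← Real.sqrt_mul hCG10, ← Real.sqrt_mul (by positivity)]
    have h := hCG1 U hU
    rw [← mul_assoc] at h
    exact Real.sqrt_le_sqrt ((Torus.latNormSq_mono hG (Nat.zero_le 1)).trans h)
  have hGm : Real.sqrt (Torus.latNormSq m G) ≤ Real.sqrt CGm * Real.sqrt (Torus.latNormSq 3 U) * Real.sqrt (Torus.latNormSq m U) := by
    rw [← Real.sqrt_mul hCGm0, ← Real.sqrt_mul (by positivity)]
    have h := hCGm U hU
    rw [← mul_assoc] at h
    exact Real.sqrt_le_sqrt h
  -- ### order zero: `∫⟪convect W U − G, U⟫`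
  have hint1 : Integrable (fun ξ => ⟪Torus.convect W U ξ, U ξ⟫) volume := ((hW.convect hU).inner hU).integrable
  have hint2 : Integrable (fun ξ => ⟪G ξ, U ξ⟫) volume := (hG.inner hU).integrable
  have h0split : ∫ ξ, ⟪klOp L hL hU ξ, U ξ⟫ = (∫ ξ, ⟪Torus.convect W U ξ, U ξ⟫) - ∫ ξ, ⟪G ξ, U ξ⟫ := by
    rw [← integral_sub hint1 hint2]
    refine integral_congr_ae (ae_of_all _ fun ξ => ?_)
    show ⟪Torus.convect W U ξ - G ξ, U ξ⟫ = _
    rw [inner_sub_left]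
  have h0a := hC₀ W U hW hU
  have h0b : |∫ ξ, ⟪G ξ, U ξ⟫| ≤ Real.sqrt (Torus.latNormSq 0 G) * Real.sqrt (Torus.latNormSq 0 U) := by
    have := abs_integral_inner_le_sqrt_mul_sqrt hG hU
    rwa [← Torus.latNormSq_zero hG, ← Torus.latNormSq_zero hU] at this
  have h0 : |∫ ξ, ⟪klOp L hL hU ξ, U ξ⟫| ≤ (C₀ * Real.sqrt CW3 + Real.sqrt CG1) * Real.sqrt (Torus.latNormSq 3 U) * Torus.latNormSq m U := by
    rw [h0split]
    refine (abs_sub _ _).trans ?_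
    have e1 : |∫ ξ, ⟪Torus.convect W U ξ, U ξ⟫| ≤ C₀ * Real.sqrt CW3 * Real.sqrt (Torus.latNormSq 3 U) * Torus.latNormSq m U := by
      calc _ ≤ C₀ * Real.sqrt (Torus.latNormSq 3 W) * Torus.latNormSq 0 U := h0a
        _ ≤ C₀ * (Real.sqrt CW3 * Real.sqrt (Torus.latNormSq 3 U)) * Torus.latNormSq m U :=
            mul_le_mul (mul_le_mul_of_nonneg_left hW3 hC₀0) (hl01.trans hl1m) l0 (by positivity)
        _ = _ := by ring
    have e2 : |∫ ξ, ⟪G ξ, U ξ⟫| ≤ Real.sqrt CG1 * Real.sqrt (Torus.latNormSq 3 U) * Torus.latNormSq m U := by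
      calc _ ≤ Real.sqrt (Torus.latNormSq 0 G) * Real.sqrt (Torus.latNormSq 0 U) := h0b
        _ ≤ (Real.sqrt CG1 * Real.sqrt (Torus.latNormSq 3 U) * Real.sqrt (Torus.latNormSq 1 U)) * Real.sqrt (Torus.latNormSq m U) :=
            mul_le_mul hG0 (Real.sqrt_le_sqrt (hl01.trans hl1m)) (Real.sqrt_nonneg _) (by positivity)
        _ ≤ (Real.sqrt CG1 * Real.sqrt (Torus.latNormSq 3 U) * Real.sqrt (Torus.latNormSq m U)) * Real.sqrt (Torus.latNormSq m U) :=
            mul_le_mul_of_nonneg_right (mul_le_mul_of_nonneg_left (Real.sqrt_le_sqrt hl1m) (by positivity)) (Real.sqrt_nonneg _)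
        _ = _ := by rw [mul_assoc, Real.mul_self_sqrt lm]
    linarith
  -- ### order `m`: each coordinate
  have hi : ∀ i : Fin 3, |∫ ξ, ⟪(Torus.partialDeriv i)^[m] (klOp L hL hU) ξ, (Torus.partialDeriv i)^[m] U ξ⟫| ≤
      (Cc * (Real.sqrt CW3 + Real.sqrt CWm) + q ^ m * Real.sqrt CGm) * Real.sqrt (Torus.latNormSq 3 U) * Torus.latNormSq m U := by
    intro i
    have hz := Torus.isSmooth_iterate_partialDeriv hU i m
    have hcW := Torus.isSmooth_iterate_partialDeriv (hW.convect hU) i m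
    have hcG := Torus.isSmooth_iterate_partialDeriv hG i m
    -- `∂ᵢᵐ` of the difference
    have hsub : (Torus.partialDeriv i)^[m] (klOp L hL hU) = fun ξ =>
        (Torus.partialDeriv i)^[m] (Torus.convect W U) ξ - (Torus.partialDeriv i)^[m] G ξ := by
      rw [← Torus.wordDeriv_replicate, ← Torus.wordDeriv_replicate, ← Torus.wordDeriv_replicate]
      exact Torus.wordDeriv_fun_sub (hW.convect hU) hG (List.replicate m i)
    have hintc : Integrable (fun ξ => ⟪(Torus.partialDeriv i)^[m] (Torus.convect W U) ξ, (Torus.partialDeriv i)^[m] U ξ⟫) volume :=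
      (hcW.inner hz).integrable
    have hintg : Integrable (fun ξ => ⟪(Torus.partialDeriv i)^[m] G ξ, (Torus.partialDeriv i)^[m] U ξ⟫) volume :=
      (hcG.inner hz).integrable
    have hsplit : ∫ ξ, ⟪(Torus.partialDeriv i)^[m] (klOp L hL hU) ξ, (Torus.partialDeriv i)^[m] U ξ⟫ =
        (∫ ξ, ⟪(Torus.partialDeriv i)^[m] (Torus.convect W U) ξ, (Torus.partialDeriv i)^[m] U ξ⟫) -
          ∫ ξ, ⟪(Torus.partialDeriv i)^[m] G ξ, (Torus.partialDeriv i)^[m] U ξ⟫ := by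
      rw [← integral_sub hintc hintg, hsub]
      refine integral_congr_ae (ae_of_all _ fun ξ => ?_)
      show ⟪_ - _, _⟫ = _
      rw [inner_sub_left]
    -- the convective part: tame commutator
    have hc := hCc W U hW hU i
    have htame : Torus.tameRHS m W U ≤ (Real.sqrt CW3 + Real.sqrt CWm) * Real.sqrt (Torus.latNormSq 3 U) * Torus.latNormSq m U := by
      unfold Torus.tameRHS
      have e1 : Real.sqrt (Torus.latNormSq 3 W) * Torus.latNormSq m U ≤ Real.sqrt CW3 * Real.sqrt (Torus.latNormSq 3 U) * Torus.latNormSq m U :=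
        mul_le_mul_of_nonneg_right hW3 lm
      have e2 : Real.sqrt (Torus.latNormSq m W) * Real.sqrt (Torus.latNormSq 3 U) * Real.sqrt (Torus.latNormSq m U) ≤
          Real.sqrt CWm * Real.sqrt (Torus.latNormSq 3 U) * Torus.latNormSq m U := by
        calc _ ≤ (Real.sqrt CWm * Real.sqrt (Torus.latNormSq m U)) * Real.sqrt (Torus.latNormSq 3 U) * Real.sqrt (Torus.latNormSq m U) :=
              mul_le_mul_of_nonneg_right (mul_le_mul_of_nonneg_right hWm (Real.sqrt_nonneg _)) (Real.sqrt_nonneg _)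
          _ = Real.sqrt CWm * Real.sqrt (Torus.latNormSq 3 U) * (Real.sqrt (Torus.latNormSq m U) * Real.sqrt (Torus.latNormSq m U)) := by ring
          _ = _ := by rw [Real.mul_self_sqrt lm]
      linarith
    -- the pressure part: Cauchy–Schwarz
    have hg : |∫ ξ, ⟪(Torus.partialDeriv i)^[m] G ξ, (Torus.partialDeriv i)^[m] U ξ⟫| ≤
        q ^ m * Real.sqrt CGm * Real.sqrt (Torus.latNormSq 3 U) * Torus.latNormSq m U := by
      have h1 := abs_integral_inner_le_sqrt_mul_sqrt hcG hz
      have h2 := Torus.sqrt_integral_norm_sq_iterate_le hG m i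
      have h3 := Torus.sqrt_integral_norm_sq_iterate_le hU m i
      calc _ ≤ Real.sqrt (∫ ξ, ‖(Torus.partialDeriv i)^[m] G ξ‖ ^ 2) * Real.sqrt (∫ ξ, ‖(Torus.partialDeriv i)^[m] U ξ‖ ^ 2) := h1
        _ ≤ (Real.sqrt (q ^ m) * Real.sqrt (Torus.latNormSq m G)) * (Real.sqrt (q ^ m) * Real.sqrt (Torus.latNormSq m U)) :=
            mul_le_mul h2 h3 (Real.sqrt_nonneg _) (by positivity)
        _ ≤ (Real.sqrt (q ^ m) * (Real.sqrt CGm * Real.sqrt (Torus.latNormSq 3 U) * Real.sqrt (Torus.latNormSq m U))) *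
              (Real.sqrt (q ^ m) * Real.sqrt (Torus.latNormSq m U)) :=
            mul_le_mul_of_nonneg_right (mul_le_mul_of_nonneg_left hGm (Real.sqrt_nonneg _)) (by positivity)
        _ = (Real.sqrt (q ^ m) * Real.sqrt (q ^ m)) * Real.sqrt CGm * Real.sqrt (Torus.latNormSq 3 U) *
              (Real.sqrt (Torus.latNormSq m U) * Real.sqrt (Torus.latNormSq m U)) := by ring
        _ = _ := by rw [Real.mul_self_sqrt (by positivity), Real.mul_self_sqrt lm]
    rw [hsplit]
    refine (abs_sub _ _).trans ?_
    have := hc.trans (mul_le_mul_of_nonneg_left htame hCc0)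
    nlinarith [this, hg]
  -- ### assembly
  have hsum : |∑ i, ∫ ξ, ⟪(Torus.partialDeriv i)^[m] (klOp L hL hU) ξ, (Torus.partialDeriv i)^[m] U ξ⟫| ≤
      3 * ((Cc * (Real.sqrt CW3 + Real.sqrt CWm) + q ^ m * Real.sqrt CGm) * Real.sqrt (Torus.latNormSq 3 U) * Torus.latNormSq m U) := by
    refine (abs_sum_le_sum_abs _ _).trans ?_
    calc ∑ i, |∫ ξ, ⟪(Torus.partialDeriv i)^[m] (klOp L hL hU) ξ, (Torus.partialDeriv i)^[m] U ξ⟫|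
        ≤ ∑ _i : Fin 3, (Cc * (Real.sqrt CW3 + Real.sqrt CWm) + q ^ m * Real.sqrt CGm) * Real.sqrt (Torus.latNormSq 3 U) * Torus.latNormSq m U :=
          sum_le_sum fun i _ => hi i
      _ = _ := by rw [sum_const, card_univ, Fintype.card_fin]; simp [nsmul_eq_mul]
  calc |(∫ ξ, ⟪klOp L hL hU ξ, U ξ⟫) + ∑ i, ∫ ξ, ⟪(Torus.partialDeriv i)^[m] (klOp L hL hU) ξ, (Torus.partialDeriv i)^[m] U ξ⟫|
      ≤ |∫ ξ, ⟪klOp L hL hU ξ, U ξ⟫| + |∑ i, ∫ ξ, ⟪(Torus.partialDeriv i)^[m] (klOp L hL hU) ξ, (Torus.partialDeriv i)^[m] U ξ⟫| :=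
        abs_add_le _ _
    _ ≤ (C₀ * Real.sqrt CW3 + Real.sqrt CG1) * Real.sqrt (Torus.latNormSq 3 U) * Torus.latNormSq m U +
          3 * ((Cc * (Real.sqrt CW3 + Real.sqrt CWm) + q ^ m * Real.sqrt CGm) * Real.sqrt (Torus.latNormSq 3 U) * Torus.latNormSq m U) :=
        add_le_add h0 hsum
    _ ≤ _ := by
        have hK1 : 0 ≤ C₀ * Real.sqrt CW3 + Real.sqrt CG1 := by positivity
        have hK2 : 0 ≤ Cc * (Real.sqrt CW3 + Real.sqrt CWm) + q ^ m * Real.sqrt CGm := by positivity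
        have hs3 := Real.sqrt_nonneg (Torus.latNormSq 3 U)
        nlinarith [mul_nonneg (mul_nonneg hK1 hs3) l0, mul_nonneg (mul_nonneg hK2 hs3) l0]

end PeriodicCylinder

end Literature.Analysis.FluidPDE
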